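import Literature.AlgebraicGeometry.Motives.HodgeLieSemisimpleTimesAbelian
import HarnessLib

/-!
# The centre and the derived algebra of `𝔥(H₁ ⊕ H₂) = 𝔥(H₁) × 𝔥(H₂)` (`𝔥(H₁)` centre-free, `𝔥(H₂)` abelian):
# `𝔷(H₁ ⊕ H₂) = ι₂ 𝔥(H₂) π₂`, `dim 𝔷 = dim 𝔥(H₂)`, `dim [𝔥, 𝔥] = dim 𝔥(H₁)`

Family `hodge`, layer `Literature/AlgebraicGeometry/Motives`; THEOREMS ONLY (no definition, no named fact; net debt 0).
Written for the cell `pub-hodgecm2` (COR-CM), seat `b27` gen 43 (count-neutral Mumford–Tate-rank ladder).  Sequel of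
`Motives/HodgeLieSemisimpleTimesAbelian` (same hypotheses and notation: a polarizable pure `ℚ`-Hodge structure `H`
decomposed by morphisms `ι_i : H_i → H`, `π_i : H → H_i`, `π_i ι_i = id`, `ι₁ π₁ + ι₂ π₂ = id`, with
`𝔥(H₁) ∩ End_Hdg(H₁) = 0` and `𝔥(H₂)` commutative; there: `𝔥(H) = {ι₁ Y₁ π₁ + ι₂ Y₂ π₂}`, `dim 𝔥(H) = dim 𝔥(H₁) + dim 𝔥(H₂)`).

Here the two summands of the reductive decomposition `𝔥(H) = 𝔷(H) ⊕ [𝔥(H), 𝔥(H)]` (`𝔷(H) = 𝔥(H) ∩ End_Hdg(H)`, the tree's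
`AnyWeight.hodgeLie_center_sup_derived_eq` / `finrank_hodgeLie_eq_center_add_derived`, Deligne I 3.6) are identified:
* **`mem_hodgeLie_inf_endAlg_iff_of_centerFree_of_abelian`** — `Z ∈ 𝔥(H) ∩ End_Hdg(H)` iff `Z = ι₂ Y₂ π₂` with `Y₂ ∈ 𝔥(H₂)`:
  the CENTRE of `𝔥(H₁ ⊕ H₂)` is the abelian factor (`ι₂ Y₂ π₂` commutes with `𝔥(H)` since `𝔥(H₂)` is abelian and
  `π₂ ι₁ = 0`, `π₁ ι₂ = 0`; conversely a central `Z` has `e₁ Z = 0`, `comp_eq_zero_of_mem_center_of_centerFree`);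
* **`finrank_hodgeLie_inf_endAlg_eq_of_centerFree_of_abelian`** — `dim_ℚ 𝔷(H) = dim_ℚ 𝔥(H₂)`;
* **`finrank_hodgeLie_derived_eq_of_centerFree_of_abelian`** — `dim_ℚ [𝔥(H), 𝔥(H)] = dim_ℚ 𝔥(H₁)` (by
  `dim 𝔥 = dim 𝔷 + dim [𝔥, 𝔥]`).
For complex abelian varieties `X ∼ X₁ × X₂` (`X₁` without factor of type IV, `X₂` of CM type): the centre of `Hg(X)` has
dimension `dim Hg(X₂)` and the semisimple part has dimension `dim Hg(X₁)` (Moonen–Zarhin 1999 Thm. (3.2)(2)).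

## References
* [MoonenZarhin1999LowDim] B. Moonen, Yu. Zarhin, *Hodge classes on abelian varieties of low dimension*, Math. Ann. 315
  (1999), §3 (3.1), Thm. (3.2)(2) [corpus: paper:arxiv-math_9901113 p. 6]. [cite: MoonenZarhin1999LowDim, §3 Thm. (3.2)(2)]
* [Deligne1982HodgeCycles] P. Deligne, *Hodge cycles on abelian varieties*, LNM 900 (1982), I §3.1, Prop. 3.4 and Prop. 3.6
  («`MT(V, h)` is reductive»). [cite: Deligne1982HodgeCycles, I §3 Prop. 3.6]
* [Hazama1989] F. Hazama, *Algebraic cycles on nonsimple abelian varieties*, Duke Math. J. 58 (1989) 31–37.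
  [cite: Hazama1989, Thm. (= Gordon 7.6.2)]
-/

noncomputable section

namespace Literature.AlgebraicGeometry.Motives

namespace HodgeStructure

universe u

variable {V₁ : Type u} [AddCommGroup V₁] [Module ℚ V₁] [Module.Finite ℚ V₁]
  {V₂ : Type u} [AddCommGroup V₂] [Module ℚ V₂] [Module.Finite ℚ V₂]
  {V : Type u} [AddCommGroup V] [Module ℚ V] [Module.Finite ℚ V] [HodgeTensorFacts.{u, u}] {n : ℤ}
  {H₁ : HodgeStructure V₁ n} {H₂ : HodgeStructure V₂ n} {H : HodgeStructure V n}
  (ι₁ : Hom H₁ H) (π₁ : Hom H H₁) (ι₂ : Hom H₂ H) (π₂ : Hom H H₂)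
  (hπι₁ : ∀ v, π₁.toLinearMap (ι₁.toLinearMap v) = v) (hπι₂ : ∀ v, π₂.toLinearMap (ι₂.toLinearMap v) = v)
  (hsum : ∀ v, ι₁.toLinearMap (π₁.toLinearMap v) + ι₂.toLinearMap (π₂.toLinearMap v) = v)
  (ψ : H.Polarization)
  (hz₁ : H₁.hodgeLie ⊓ Subalgebra.toSubmodule H₁.endAlg = ⊥)
  (hab₂ : ∀ A ∈ H₂.hodgeLie, ∀ B ∈ H₂.hodgeLie, A * B = B * A)

omit [Module.Finite ℚ V₁] [Module.Finite ℚ V₂] [Module.Finite ℚ V] [HodgeTensorFacts.{u, u}] in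
include hπι₁ hπι₂ hsum in
/-- `π₂ ι₁ = 0` (private plumbing, as in `HodgeLieSemisimpleTimesAbelian`). [folklore] -/
private theorem proj₂_incl₁_eq_zero' (v : V₁) : π₂.toLinearMap (ι₁.toLinearMap v) = 0 := by
  have h := congrArg π₂.toLinearMap (hsum (ι₁.toLinearMap v))
  rw [map_add, hπι₁ v, hπι₂] at h
  exact add_eq_left.1 h

omit [Module.Finite ℚ V₁] [Module.Finite ℚ V₂] [Module.Finite ℚ V] [HodgeTensorFacts.{u, u}] in
include hπι₁ hπι₂ hsum in
/-- `π₁ ι₂ = 0` (private plumbing). [folklore] -/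
private theorem proj₁_incl₂_eq_zero' (v : V₂) : π₁.toLinearMap (ι₂.toLinearMap v) = 0 := by
  have h := congrArg π₁.toLinearMap (hsum (ι₂.toLinearMap v))
  rw [map_add, hπι₂ v, hπι₁] at h
  exact add_eq_left.1 h

include hπι₁ hπι₂ hsum ψ hz₁ hab₂ in
/-- **`ι₂ Y₂ π₂` is central in `𝔥(H)` for `Y₂ ∈ 𝔥(H₂)`** (`𝔥(H₂)` abelian): it commutes with every
`X = ι₁ Y₁ π₁ + ι₂ Y₂' π₂ ∈ 𝔥(H)` because `π₂ ι₁ = 0`, `π₁ ι₂ = 0` and `Y₂ Y₂' = Y₂' Y₂`.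
[cite: MoonenZarhin1999LowDim, §3 Thm. (3.2)(2)] -/
theorem comp_comp_mem_centralizer_hodgeLie_of_centerFree_of_abelian {Y₂ : Module.End ℚ V₂} (hY₂ : Y₂ ∈ H₂.hodgeLie) :
    ι₂.toLinearMap ∘ₗ Y₂ ∘ₗ π₂.toLinearMap ∈
      Subalgebra.centralizer ℚ (H.hodgeLie : Set (Module.End ℚ V)) := by
  rw [Subalgebra.mem_centralizer_iff]
  intro X hX
  obtain ⟨Y₁, -, Y₂', hY₂', rfl⟩ :=
    (mem_hodgeLie_iff_of_centerFree_of_abelian ι₁ π₁ ι₂ π₂ hπι₁ hπι₂ hsum ψ hz₁ hab₂ X).1 hX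
  have hc := hab₂ _ hY₂' _ hY₂
  refine LinearMap.ext fun v => ?_
  have hcv := LinearMap.congr_fun hc (π₂.toLinearMap v)
  simp only [Module.End.mul_apply] at hcv
  simp only [Module.End.mul_apply, LinearMap.add_apply, LinearMap.comp_apply, map_add, hπι₂,
    proj₂_incl₁_eq_zero' ι₁ π₁ ι₂ π₂ hπι₁ hπι₂ hsum, proj₁_incl₂_eq_zero' ι₁ π₁ ι₂ π₂ hπι₁ hπι₂ hsum, map_zero,
    zero_add, hcv]

include hπι₁ hπι₂ hsum ψ hz₁ hab₂ in
/-- **The centre of `𝔥(H₁ ⊕ H₂)` is the abelian factor: `Z ∈ 𝔥(H) ∩ End_Hdg(H)` iff `Z = ι₂ Y₂ π₂` with `Y₂ ∈ 𝔥(H₂)`**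
(`𝔥(H₁)` centre-free, `𝔥(H₂)` abelian; `𝔥 ∩ End_Hdg = 𝔥 ∩ centralizer(𝔥)`, `hodgeLie_center_eq_inf_endAlg`).
[cite: MoonenZarhin1999LowDim, §3 Thm. (3.2)(2)] [cite: Deligne1982HodgeCycles, I §3 Prop. 3.6] -/
theorem mem_hodgeLie_inf_endAlg_iff_of_centerFree_of_abelian (Z : Module.End ℚ V) :
    Z ∈ H.hodgeLie ⊓ Subalgebra.toSubmodule H.endAlg ↔
      ∃ Y₂ ∈ H₂.hodgeLie, Z = ι₂.toLinearMap ∘ₗ Y₂ ∘ₗ π₂.toLinearMap := by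
  constructor
  · intro hZ
    obtain ⟨hZ𝔥, hZe⟩ := Submodule.mem_inf.1 hZ
    have hZe' : Z ∈ H.endAlg := (Subalgebra.mem_toSubmodule _).1 hZe
    refine ⟨_, comp_mem_hodgeLie_of_retract ι₂ π₂ hπι₂ hZ𝔥, ?_⟩
    have h1 : (ι₁.toLinearMap ∘ₗ π₁.toLinearMap) ∘ₗ Z = 0 :=
      comp_eq_zero_of_mem_center_of_centerFree ι₁ π₁ ι₂ π₂ hπι₁ hπι₂ hsum hz₁ hZ𝔥 hZe'
    have h := eq_sum_blocks_of_mem_hodgeLie ι₁ π₁ ι₂ π₂ hπι₁ hπι₂ hsum hZ𝔥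
    refine LinearMap.ext fun v => ?_
    have h1v := LinearMap.congr_fun h1 (ι₁.toLinearMap (π₁.toLinearMap v))
    simp only [LinearMap.comp_apply, LinearMap.zero_apply] at h1v
    -- `π₁ Z ι₁ π₁ v = π₁ (e₁ Z (ι₁ π₁ v)) = 0`
    have h0 : π₁.toLinearMap (Z (ι₁.toLinearMap (π₁.toLinearMap v))) = 0 := by
      have := congrArg π₁.toLinearMap h1v
      rwa [hπι₁, map_zero] at this
    conv_lhs => rw [h]
    simp only [LinearMap.add_apply, LinearMap.comp_apply, h0, map_zero, zero_add]
  · rintro ⟨Y₂, hY₂, rfl⟩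
    have h𝔥 := comp_comp_mem_hodgeLie_right_of_centerFree_of_abelian ι₁ π₁ ι₂ π₂ hπι₁ hπι₂ hsum ψ hz₁ hab₂ hY₂
    have hc := comp_comp_mem_centralizer_hodgeLie_of_centerFree_of_abelian ι₁ π₁ ι₂ π₂ hπι₁ hπι₂ hsum ψ hz₁ hab₂ hY₂
    have hmem : ι₂.toLinearMap ∘ₗ Y₂ ∘ₗ π₂.toLinearMap ∈
        H.hodgeLie ⊓ Subalgebra.toSubmodule (Subalgebra.centralizer ℚ (H.hodgeLie : Set (Module.End ℚ V))) :=
      Submodule.mem_inf.2 ⟨h𝔥, (Subalgebra.mem_toSubmodule _).2 hc⟩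
    rwa [hodgeLie_center_eq_inf_endAlg] at hmem

include hπι₁ hπι₂ hsum ψ hz₁ hab₂ in
/-- **`dim_ℚ 𝔷(H₁ ⊕ H₂) = dim_ℚ 𝔥(H₂)`** (`𝔷 = 𝔥 ∩ End_Hdg`; `𝔥(H₁)` centre-free, `𝔥(H₂)` abelian): `Y₂ ↦ ι₂ Y₂ π₂` is a
linear bijection `𝔥(H₂) ≅ 𝔷(H)`.  For abelian varieties: the centre of `Hg(X₁ × X₂)` is `Hg(X₂)` when `Hg(X₁)` is
semisimple and `X₂` is of CM type. [cite: MoonenZarhin1999LowDim, §3 Thm. (3.2)(2)] [cite: Deligne1982HodgeCycles, I §3 Prop. 3.6] -/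
theorem finrank_hodgeLie_inf_endAlg_eq_of_centerFree_of_abelian :
    Module.finrank ℚ ↥(H.hodgeLie ⊓ Subalgebra.toSubmodule H.endAlg) = Module.finrank ℚ H₂.hodgeLie := by
  let Φ : H₂.hodgeLie →ₗ[ℚ] ↥(H.hodgeLie ⊓ Subalgebra.toSubmodule H.endAlg) :=
    { toFun := fun Y => ⟨ι₂.toLinearMap ∘ₗ (Y : Module.End ℚ V₂) ∘ₗ π₂.toLinearMap,
        (mem_hodgeLie_inf_endAlg_iff_of_centerFree_of_abelian ι₁ π₁ ι₂ π₂ hπι₁ hπι₂ hsum ψ hz₁ hab₂ _).2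
          ⟨_, Y.2, rfl⟩⟩
      map_add' := fun Y Z => Subtype.ext (by
        simp only [Submodule.coe_add, LinearMap.comp_add, LinearMap.add_comp])
      map_smul' := fun c Y => Subtype.ext (by
        simp only [Submodule.coe_smul, LinearMap.comp_smul, LinearMap.smul_comp, RingHom.id_apply]) }
  have hΦ : ∀ Y : H₂.hodgeLie, ((Φ Y : ↥(H.hodgeLie ⊓ Subalgebra.toSubmodule H.endAlg)) : Module.End ℚ V) =
      ι₂.toLinearMap ∘ₗ (Y : Module.End ℚ V₂) ∘ₗ π₂.toLinearMap := fun _ => rfl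
  have hb : ∀ Y₂ : Module.End ℚ V₂,
      π₂.toLinearMap ∘ₗ (ι₂.toLinearMap ∘ₗ Y₂ ∘ₗ π₂.toLinearMap) ∘ₗ ι₂.toLinearMap = Y₂ := fun Y₂ => by
    refine LinearMap.ext fun v => ?_
    simp only [LinearMap.comp_apply, hπι₂]
  have hinj : Function.Injective Φ := fun Y Z hYZ => by
    have h := congrArg (fun W : ↥(H.hodgeLie ⊓ Subalgebra.toSubmodule H.endAlg) => (W : Module.End ℚ V)) hYZ
    simp only [hΦ] at h
    refine Subtype.ext ?_
    rw [← hb (Y : Module.End ℚ V₂), h, hb]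
  have hsurj : Function.Surjective Φ := fun W => by
    obtain ⟨Y₂, hY₂, hW⟩ :=
      (mem_hodgeLie_inf_endAlg_iff_of_centerFree_of_abelian ι₁ π₁ ι₂ π₂ hπι₁ hπι₂ hsum ψ hz₁ hab₂ _).1 W.2
    exact ⟨⟨Y₂, hY₂⟩, Subtype.ext (by rw [hΦ]; exact hW.symm)⟩
  exact ((LinearEquiv.ofBijective Φ ⟨hinj, hsurj⟩).finrank_eq).symm

include hπι₁ hπι₂ hsum ψ hz₁ hab₂ in
/-- **`dim_ℚ [𝔥(H), 𝔥(H)] = dim_ℚ 𝔥(H₁)`** for `H ≅ H₁ ⊕ H₂` with `𝔥(H₁)` centre-free and `𝔥(H₂)` abelian: from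
`dim 𝔥(H) = dim 𝔷(H) + dim [𝔥(H), 𝔥(H)]` (`AnyWeight.finrank_hodgeLie_eq_center_add_derived`), `dim 𝔥(H) = dim 𝔥(H₁) + dim 𝔥(H₂)`
and `dim 𝔷(H) = dim 𝔥(H₂)`.  For abelian varieties: the semisimple part of `Hg(X₁ × X₂)` has the dimension of `Hg(X₁)`.
[cite: MoonenZarhin1999LowDim, §3 Thm. (3.2)(2)] [cite: Deligne1982HodgeCycles, I §3 Prop. 3.6] -/
theorem finrank_hodgeLie_derived_eq_of_centerFree_of_abelian :
    Module.finrank ℚ ↥(Submodule.span ℚ {B | ∃ X ∈ H.hodgeLie, ∃ Y ∈ H.hodgeLie, X * Y - Y * X = B}) =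
      Module.finrank ℚ H₁.hodgeLie := by
  have h1 := AnyWeight.finrank_hodgeLie_eq_center_add_derived H ψ
  rw [finrank_hodgeLie_eq_add_of_centerFree_of_abelian ι₁ π₁ ι₂ π₂ hπι₁ hπι₂ hsum ψ hz₁ hab₂,
    finrank_hodgeLie_inf_endAlg_eq_of_centerFree_of_abelian ι₁ π₁ ι₂ π₂ hπι₁ hπι₂ hsum ψ hz₁ hab₂] at h1
  omega

end HodgeStructure

end Literature.AlgebraicGeometry.Motives

end
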